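import Mathlib
import Literature.Computability.AlgebraicComplexity.FixedPointLog
import HarnessLib

/-!
# ζ(5) search — kernel interval bounds for `y · log y` at rational `y` (a `ℚ` front end to the Literature
# fixed-point logarithms)

HONEST FRAMING: systematic search; no irrationality claim unless certified. This module certifies NOTHING
about ζ(5): it is a small, generic, computable front end, in the cell's kernel-certificate pattern
(`KernelKit.lean`, `LaiBoxUnimodal.domCheck`): computable `ℚ`-valued bounds + ONE soundness theorem each, so
that a numerical inequality between sums of `y·log y` at rational points becomes one `decide +kernel`.

It REUSES the tree's proved fixed-point logarithm kit `Literature.Computability.AlgebraicComplexity.FixedPoint`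
(`FixedPointLog.lean`: `logRatLo/Hi P K en ed num den` enclose `2^P·log(num/den)` given range hints checked by
`inRange`; soundness `logRat_sound_of_inRange`) and adds only:

* `log2Fuel` / `logHint` — the range hint `e = ⌊log₂ m⌋` by structural recursion (CHECKED by `inRange` inside
  `logRLo/Hi`, never trusted: if a hint were wrong the bound falls back to the crude but valid
  `|log|y|| ≤ |y| + 1/|y|`, so soundness is unconditional);
* `logRLo y ≤ log y ≤ logRHi y` for every non-zero `y : ℚ` (`logR_bounds`; precision `klogPrec = 40` bits,
  `klogTerms = 12` series terms: absolute error `< 10⁻¹⁰`, irrelevant to soundness);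
* `xlnxLoQ y ≤ y·log y ≤ xlnxHiQ y` for EVERY `y : ℚ`, the sign of `y` handled by `min`/`max`
  (`xlnxLoQ_le`, `mul_log_le_xlnxHiQ`).

Cell `pub-zeta5` (summit KontsevichZagierPeriods, topic Zeta5Search), family `indep` (LINEAR-INDEPENDENCE /
DIMENSION route), generation 5. First consumer: `LaiDecayAlpha.lean` (the enclosure `α ≥ 38725.5` of the decay
rate of the κ₃ ladder point: an upper bound for the maximum of the 230-term profile `laiProfile 74 2180 444 δ74`).

References: `Literature/Computability/AlgebraicComplexity/FixedPointLog.lean` (this tree; the `atanh` series with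
directed rounding, [folklore], analytic input Mathlib `Real.hasSum_log_sub_log_of_abs_lt_one`).
-/

namespace Summit.KontsevichZagierPeriods.Zeta5Search.KernelLog

open Literature.Computability.AlgebraicComplexity

/-! ### Computable pieces -/

/-- `⌊log₂ m⌋` by structural recursion on a fuel argument (kernel-friendly; any `fuel ≥ log₂ m` is exact). -/
def log2Fuel : ℕ → ℕ → ℕ
  | 0, _ => 0
  | f + 1, m => if m < 2 then 0 else log2Fuel f (m / 2) + 1

/-- The range hint `e` with `2^e ≤ m ≤ 2^(e+1)` handed to the fixed-point kit (checked there by `inRange`). -/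
def logHint (m : ℕ) : ℕ := log2Fuel 64 m

/-- Fixed-point precision (bits) used for the logarithms. -/
def klogPrec : ℕ := 40

/-- Number of `atanh`-series terms used for the logarithms. -/
def klogTerms : ℕ := 12

/-- The kit's range checks for numerator and denominator of `y`. -/
def logOK (y : ℚ) : Bool :=
  FixedPoint.inRange (logHint y.num.natAbs) y.num.natAbs && FixedPoint.inRange (logHint y.den) y.den

/-- **Lower bound for `log y = log |y|`** (`y ≠ 0`): the kit's `logRatLo / 2^P`, or the crude valid fallback
`−(|y| + 1/|y|)` if a range check failed. -/
def logRLo (y : ℚ) : ℚ :=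
  if logOK y then
    ((FixedPoint.logRatLo klogPrec klogTerms (logHint y.num.natAbs) (logHint y.den) y.num.natAbs y.den : ℤ) : ℚ) /
      ((2 ^ klogPrec : ℕ) : ℚ)
  else -(|y| + 1 / |y|)

/-- **Upper bound for `log y = log |y|`** (`y ≠ 0`): the kit's `logRatHi / 2^P`, or the fallback `|y| + 1/|y|`. -/
def logRHi (y : ℚ) : ℚ :=
  if logOK y then
    ((FixedPoint.logRatHi klogPrec klogTerms (logHint y.num.natAbs) (logHint y.den) y.num.natAbs y.den : ℤ) : ℚ) /
      ((2 ^ klogPrec : ℕ) : ℚ)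
  else |y| + 1 / |y|

/-- **Lower bound for `y · log y`** (`y : ℚ` arbitrary; the sign of `y` handled by `min`). -/
def xlnxLoQ (y : ℚ) : ℚ := min (y * logRLo y) (y * logRHi y)

/-- **Upper bound for `y · log y`** (`y : ℚ` arbitrary). -/
def xlnxHiQ (y : ℚ) : ℚ := max (y * logRLo y) (y * logRHi y)

/-! ### Soundness -/

/-- `|y| = |num y| / den y` as reals. -/
theorem abs_cast_eq (y : ℚ) : |(y : ℝ)| = (y.num.natAbs : ℝ) / (y.den : ℝ) := by
  rw [Rat.cast_def y, abs_div, Nat.cast_natAbs, Int.cast_abs, Nat.abs_cast]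

/-- The crude fallback: `−(t + 1/t) ≤ log t ≤ t + 1/t` for `t > 0`. -/
theorem abs_log_le_crude {t : ℝ} (ht : 0 < t) : -(t + 1 / t) ≤ Real.log t ∧ Real.log t ≤ t + 1 / t := by
  have h1 := Real.log_le_sub_one_of_pos ht
  have h2 := Real.log_le_sub_one_of_pos (inv_pos.2 ht)
  rw [Real.log_inv] at h2
  have h3 : 0 < 1 / t := by positivity
  rw [inv_eq_one_div] at h2
  constructor <;> linarith

/-- **Soundness of the logarithm bounds**: `logRLo y ≤ log y ≤ logRHi y` for every `y ≠ 0`. -/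
theorem logR_bounds (y : ℚ) (hy : y ≠ 0) :
    ((logRLo y : ℚ) : ℝ) ≤ Real.log (y : ℝ) ∧ Real.log (y : ℝ) ≤ ((logRHi y : ℚ) : ℝ) := by
  have hT : 0 < |(y : ℝ)| := abs_pos.2 (by exact_mod_cast hy)
  rw [← Real.log_abs]
  by_cases hok : logOK y = true
  · have hok' := hok
    simp only [logOK, Bool.and_eq_true] at hok'
    obtain ⟨h1, h2⟩ := FixedPoint.logRat_sound_of_inRange klogPrec klogTerms hok'.1 hok'.2
    rw [← abs_cast_eq] at h1 h2
    have hP : (0 : ℝ) < ((2 ^ klogPrec : ℕ) : ℝ) := by positivity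
    have hP' : ((2 ^ klogPrec : ℕ) : ℝ) = (2 : ℝ) ^ klogPrec := by push_cast; ring
    simp only [logRLo, logRHi, hok, if_true]
    push_cast [Rat.cast_div]
    rw [hP'] at hP
    constructor
    · rw [div_le_iff₀ hP]; linarith
    · rw [le_div_iff₀ hP]; linarith
  · obtain ⟨h1, h2⟩ := abs_log_le_crude hT
    simp only [logRLo, logRHi, hok]
    push_cast
    exact ⟨h1, h2⟩

/-- **Soundness**: `xlnxLoQ y ≤ y · log y` for every rational `y`. -/
theorem xlnxLoQ_le (y : ℚ) : ((xlnxLoQ y : ℚ) : ℝ) ≤ (y : ℝ) * Real.log (y : ℝ) := by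
  by_cases hy : y = 0
  · subst hy; simp [xlnxLoQ]
  obtain ⟨h1, h2⟩ := logR_bounds y hy
  simp only [xlnxLoQ, Rat.cast_min, Rat.cast_mul]
  rcases le_total 0 ((y : ℚ) : ℝ) with hs | hs
  · exact (min_le_left _ _).trans (mul_le_mul_of_nonneg_left h1 hs)
  · exact (min_le_right _ _).trans (mul_le_mul_of_nonpos_left h2 hs)

/-- **Soundness**: `y · log y ≤ xlnxHiQ y` for every rational `y`. -/
theorem mul_log_le_xlnxHiQ (y : ℚ) : (y : ℝ) * Real.log (y : ℝ) ≤ ((xlnxHiQ y : ℚ) : ℝ) := by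
  by_cases hy : y = 0
  · subst hy; simp [xlnxHiQ]
  obtain ⟨h1, h2⟩ := logR_bounds y hy
  simp only [xlnxHiQ, Rat.cast_max, Rat.cast_mul]
  rcases le_total 0 ((y : ℚ) : ℝ) with hs | hs
  · exact (mul_le_mul_of_nonneg_left h2 hs).trans (le_max_right _ _)
  · exact (mul_le_mul_of_nonpos_left h1 hs).trans (le_max_left _ _)

/-- Sanity (kernel): the range hints of `17441/8` pass and its `y log y` enclosure has width `< 10⁻⁵`. -/
example : logOK (17441 / 8) = true ∧ xlnxHiQ (17441 / 8) - xlnxLoQ (17441 / 8) < 1 / 100000 := by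
  decide +kernel

end Summit.KontsevichZagierPeriods.Zeta5Search.KernelLog
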